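import Literature.AlgebraicGeometry.Resolution.DenseLiftedFrobeniusClosedBasis
import Literature.AlgebraicGeometry.Resolution.PthRootsOfOneUnits
import Literature.AlgebraicGeometry.Resolution.GaloisDegreePDefectless
import HarnessLib

/-!
# The Kummer normal form for `1`-units over a dense lifted Frobenius-closed basis (Kuhlmann 2010, §4.3, Prop. 4.13 with the proof of Prop. 4.6)

Topic: `Literature/AlgebraicGeometry/Resolution` (valued function fields). The normalisation
step of the proof of F.-V. Kuhlmann, *Elimination of ramification I: The generalized stability
theorem*, Trans. AMS 362 (2010) 5697–5727 = arXiv:1003.5678, **Prop. 4.13** (mixed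
characteristic, residue-transcendental case; towards the named fact
`Kuhlmann2010Prop413ResidueDegree`, `NormalDegreePDefectlessGalois.lean`):

> **Proposition 4.13.** Let `K`, `F` and `E` be as in the residue-transcendental case of
> Proposition 4.1, and assume that `char K = 0`. Choose a ring `R` with Frobenius-closed basis `𝓑`
> in `F|K` as in Lemma 4.11. Then `E = F(ϑ)` where `ϑ^p = ru` such that `r ∈ R` has value `0` and
> either `r = 1` or `r̄ ∉ F̄^p`, and such that `u ∈ R` is a `1`-unit of the form
> `u = 1 + ∑_{i∈I} cᵢuᵢ`, `cᵢ ∈ K`, `1 ≠ uᵢ ∈ 𝓑` where `I` is a finite index set and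
> `∀ i ∈ I: 0 < vcᵢuᵢ = vcᵢ ≤ (p/(p-1))vp` and (`uᵢ ∈ 𝓑^p ⇒ vcᵢ > vp`). If `vcᵢ ≥ (1/(p-1))vp`
> for all `i ∈ I`, then it may be assumed that no `uᵢ` at all appearing in the sum is a `p`-th
> power in `𝓑`. … In all cases, `[Ē:F̄] = p`.

The printed proof obtains these properties "by a replacement procedure as in the proof of
Proposition 4.6" (the value-transcendental case, where `𝓑 = {xⁱ}` is multiplicatively closed:
"we replace `u` by `u' := u/(1 + ∑ zⱼ)^{p^ν}` … Iterating this process until we finish with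
`ν = 1`", followed by Cor. 2.11 d): "we may replace every monomial of the form `cᵢxⁱ` with `i ∈ pℤ`
by the monomial `-pc̃ᵢx^{i/p}`"). For a general lifted Frobenius-closed basis the quotients
`u/(1 + ∑ zⱼ)^{p^ν}` re-expand into products of basis elements of uncontrolled `p`-height; this
file therefore runs the replacement procedure on a PRODUCT representation
`u ≡ ∏ (1 + c_u u) mod (F^×)^p` of the `1`-unit, in which each factor is converted separately:

* phase one (factors of level `≤ vp` whose `u ≠ 1` is a `p`-th power in `𝓑`):
  `1 + d^p r^p = (1 + dr)^p ρ` with `v(ρ - 1) > vp` — these factors disappear modulo `(F^×)^p`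
  into a `1`-unit of level `> vp`;
* phase two (level `> vp`): `1 + d^p r^p ≡ 1 - p d r` (Cor. 2.11 d)), lowering the height, the
  merging corrections being of level `> 2vp ≥ (p/(p-1))vp`, i.e. `p`-th powers (Lemma 2.10);

and then expands the product to first order. The outcome is the part of Prop. 4.13 that the
residue computation consumes (`normal_form`): `u ∈ (F^×)^p`, or
`u ≡ 1 + ∑ c_u u + R mod (F^×)^p` with a non-zero family `(c_u)` supported on elements `u ≠ 1`
of `𝓑` which are not `p`-th powers in `𝓑`, `(p/(p-1))vp ≥ v(∑ c_u u) > 0`, and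
`v(R) > v(∑ c_u u)`.

## Content (everything PROVED)

* First-order expansion of products of `1`-units (`valuation_prod_one_add_sub_le`, …), levels of
  products/quotients of `1`-units.
* `valuation_p_lt_one` (`char Ωv = p ⇒ v(p) < 1`); Lemma 2.10 in congruence form
  (`modPthPowers_one_of_valuation_sub_one_lt`); constants of `K = K^p` are `≡ 1`
  (`modPthPowers_one_of_mem`).
* `IsDenseLiftedFrobeniusClosedBasis.peel_step`, `exists_prod_mul_one_add` — **product
  representation** `w = ∏ (1 + g_u u)·(1 + t)`, `v(t) < v(ε)`, of a `1`-unit `w` of a rank-one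
  `F` (density and valuation independence; the value group being archimedean).
* `exists_one_add_pow_eq_mul` (phase-one conversion), `modPthPowers_one_sub_mul_one_add_pow`
  (phase-two conversion = Cor. 2.11 d) with `b = 0`), `modPthPowers_prod_mul_prod` (merging),
  `modPthPowers_prod_filter` (splitting), height bookkeeping (`pow_pow_ne_of_le`, …,
  `exists_uniform_height`), `phase_one`, `phase_two`, and `normal_form`.

## Sources

* F.-V. Kuhlmann, *Elimination of ramification I: The generalized stability theorem*, Trans.
  Amer. Math. Soc. 362 (2010) 5697–5727 = arXiv:1003.5678: §2.2 (Lemma 2.10, Cor. 2.11), §4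
  (4.5), §4.1 (proof of Prop. 4.6, pp. 12–13), §4.2 (Lemma 4.9), §4.3 (Prop. 4.13 and its proof,
  p. 17). [Kuhlmann2010]

## Rendering notes

* Setting of the main statements: `(Ω, V)` with `p ≠ 0` in `Ω` and `v(p) < 1` (mixed
  characteristic `(0, p)`); `K ≤ F ≤ Ω` with `(F, V ∩ F)` henselian (`IsHenselianField`) of rank
  one (`IsRankOneValued`); `C ∈ F` with `C^{p-1} = -p` (§2.2; by Lemma 2.9 this is "`F` contains
  the `p`-th roots of unity"); "`K` is closed under `p`-th roots" is `∀ c ∈ K, ∃ d ∈ K, d^p = c`;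
  `B` an `IsDenseLiftedFrobeniusClosedBasis V p K F B` (`DenseLiftedFrobeniusClosedBasis.lean`).
* Levels are multiplicative: "level `> (p/(p-1))vp`" is `v(· - 1) < v(C)^p`, "level `> vp`" is
  `v(· - 1) < v(p)`; `x ≡ y mod (F^×)^p` is `ModPthPowers F p x y`.
* The height condition "`uᵢ ∈ 𝓑^p ⇒ vcᵢ > vp`" of the printed normal form is strengthened in the
  conclusion of `normal_form` to "no `u` of the support is in `𝓑^p`" (which the source reaches
  under the extra hypothesis `vcᵢ ≥ (1/(p-1))vp`; the product representation reaches it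
  unconditionally), and the exact-sum form `u = 1 + ∑ cᵢuᵢ` is replaced by the congruence
  `u ≡ 1 + ∑ c_u u + R` with an explicit remainder of smaller size, which is all that the residue
  computation of Prop. 4.13 uses.
-/

noncomputable section

open IsLocalRing

namespace Literature.AlgebraicGeometry.Resolution

universe u

variable {Ω : Type u} [Field Ω] (V : ValuationSubring Ω)

/-! ### Products of `1`-units: the second-order expansion -/

section Products

variable {V}

/-- **First-order expansion of a product of `1`-units**: if all `v(aᵢ) ≤ γ ≤ 1` then
`∏ (1 + aᵢ) = 1 + ∑ aᵢ + R` with `v(R) ≤ γ²`. [folklore] -/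
theorem valuation_prod_one_add_sub_le {ι : Type*} (s : Finset ι) (a : ι → Ω) {γ : V.ValueGroup}
    (hγ : γ ≤ 1) (ha : ∀ i ∈ s, V.valuation (a i) ≤ γ) :
    V.valuation (∏ i ∈ s, (1 + a i) - 1 - ∑ i ∈ s, a i) ≤ γ * γ := by
  classical
  induction s using Finset.induction_on with
  | empty => simp
  | insert i s hi ih =>
    have hai : V.valuation (a i) ≤ γ := ha i (Finset.mem_insert_self i s)
    have ha' : ∀ j ∈ s, V.valuation (a j) ≤ γ := fun j hj => ha j (Finset.mem_insert_of_mem hj)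
    have ih' := ih ha'
    rw [Finset.prod_insert hi, Finset.sum_insert hi]
    set P := ∏ j ∈ s, (1 + a j) with hP
    set S := ∑ j ∈ s, a j with hS
    have hSγ : V.valuation S ≤ γ := Valuation.map_sum_le _ ha'
    -- `(1 + aᵢ) P - 1 - (aᵢ + S) = (P - 1 - S) + aᵢ (S + (P - 1 - S))`
    have key : (1 + a i) * P - 1 - (a i + S) = (P - 1 - S) + a i * (S + (P - 1 - S)) := by ring
    rw [key]
    refine Valuation.map_add_le _ ih' ?_
    rw [map_mul]
    calc V.valuation (a i) * V.valuation (S + (P - 1 - S)) ≤ γ * γ := by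
          refine mul_le_mul' hai (Valuation.map_add_le _ hSγ (ih'.trans ?_))
          exact mul_le_of_le_one_right' hγ
      _ = γ * γ := rfl

/-- A product of `1`-units of level `≤ γ` is a `1`-unit of level `≤ γ`. [folklore] -/
theorem valuation_prod_one_add_sub_one_le {ι : Type*} (s : Finset ι) (a : ι → Ω) {γ : V.ValueGroup}
    (hγ : γ ≤ 1) (ha : ∀ i ∈ s, V.valuation (a i) ≤ γ) :
    V.valuation (∏ i ∈ s, (1 + a i) - 1) ≤ γ := by
  have h1 := valuation_prod_one_add_sub_le s a hγ ha
  have h2 : V.valuation (∑ i ∈ s, a i) ≤ γ := Valuation.map_sum_le _ ha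
  have key : ∏ i ∈ s, (1 + a i) - 1 = (∏ i ∈ s, (1 + a i) - 1 - ∑ i ∈ s, a i) + ∑ i ∈ s, a i := by ring
  rw [key]
  exact Valuation.map_add_le _ (h1.trans (mul_le_of_le_one_right' hγ)) h2

/-- A `1`-unit has value `1`. [folklore] -/
theorem valuation_eq_one_of_sub_one_lt {x : Ω} (hx : V.valuation (x - 1) < 1) : V.valuation x = 1 := by
  have : x = 1 + (x - 1) := by ring
  rw [this, Valuation.map_add_eq_of_lt_left _ (by rwa [map_one]), map_one]

/-- A `1`-unit is non-zero. [folklore] -/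
theorem ne_zero_of_sub_one_lt {x : Ω} (hx : V.valuation (x - 1) < 1) : x ≠ 0 := by
  intro h0
  have := valuation_eq_one_of_sub_one_lt (V := V) hx
  rw [h0, map_zero] at this
  exact zero_ne_one this

/-- The level of a product of two `1`-units. [folklore] -/
theorem valuation_mul_sub_one_le {x y : Ω} {γ : V.ValueGroup} (hx : V.valuation (x - 1) ≤ γ)
    (hy : V.valuation (y - 1) ≤ γ) (hγ : γ ≤ 1) : V.valuation (x * y - 1) ≤ γ := by
  have key : x * y - 1 = (x - 1) + (y - 1) + (x - 1) * (y - 1) := by ring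
  rw [key]
  refine Valuation.map_add_le _ (Valuation.map_add_le _ hx hy) ?_
  rw [map_mul]
  calc V.valuation (x - 1) * V.valuation (y - 1) ≤ γ * γ := mul_le_mul' hx hy
    _ ≤ γ := mul_le_of_le_one_right' hγ

/-- The level of a product of two `1`-units, strict form. [folklore] -/
theorem valuation_mul_sub_one_lt {x y : Ω} {γ : V.ValueGroup} (hx : V.valuation (x - 1) < γ)
    (hy : V.valuation (y - 1) < γ) (hγ : γ ≤ 1) : V.valuation (x * y - 1) < γ := by
  have key : x * y - 1 = (x - 1) + (y - 1) + (x - 1) * (y - 1) := by ring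
  rw [key]
  refine Valuation.map_add_lt _ (Valuation.map_add_lt _ hx hy) ?_
  rw [map_mul]
  calc V.valuation (x - 1) * V.valuation (y - 1) ≤ V.valuation (x - 1) * 1 :=
        mul_le_mul_right (hy.le.trans hγ) _
    _ < γ := by rw [mul_one]; exact hx

/-- The level of the inverse of a `1`-unit. [folklore] -/
theorem valuation_inv_sub_one {x : Ω} (hx : V.valuation (x - 1) < 1) :
    V.valuation (x⁻¹ - 1) = V.valuation (x - 1) := by
  have hx0 := ne_zero_of_sub_one_lt (V := V) hx
  have key : x⁻¹ - 1 = -(x - 1) * x⁻¹ := by field_simp; ring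
  rw [key, map_mul, Valuation.map_neg, map_inv₀, valuation_eq_one_of_sub_one_lt (V := V) hx, inv_one,
    mul_one]

/-- The level of a quotient of two `1`-units, strict form. [folklore] -/
theorem valuation_div_sub_one_lt {x y : Ω} {γ : V.ValueGroup} (hx : V.valuation (x - 1) < γ)
    (hy : V.valuation (y - 1) < γ) (hγ : γ ≤ 1) : V.valuation (x / y - 1) < γ := by
  rw [div_eq_mul_inv]
  refine valuation_mul_sub_one_lt hx ?_ hγ
  rwa [valuation_inv_sub_one (hy.trans_le hγ)]

end Products

/-! ### The setting of Prop. 4.13: a henselian `F` of rank one over `K ∋ C`, `K = K^p` -/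

section Setting

variable {V}
variable {p : ℕ} [hp : Fact p.Prime] {K F : Subfield Ω} {B : Set Ω}

omit hp in
/-- `v(p) < 1` when `char Ωv = p`. [folklore] -/
theorem valuation_p_lt_one [CharP (ResidueField V) p] : V.valuation (p : Ω) < 1 := by
  have h0 : residue V (p : V) = 0 := by
    rw [map_natCast, CharP.cast_eq_zero]
  have hmem : (p : V) ∈ maximalIdeal V := (residue_eq_zero_iff _).mp h0
  have := (V.valuation_lt_one_iff _).mp hmem
  simpa using this

variable (hF : IsHenselianField F (V.comap (algebraMap F Ω)))
  {C : Ω} (hCF : C ∈ F) (hC : C ^ (p - 1) = -(p : Ω)) (hp0 : (p : Ω) ≠ 0)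
  (hvp : V.valuation (p : Ω) < 1)

include hF hCF hC hp0 hvp in
/-- **`1`-units of level `> λ = (p/(p-1))vp` are `p`-th powers** (Kuhlmann 2010, Lemma 2.10), in
congruence form: `v(e - 1) < v(C)^p ⇒ e ≡ 1 mod (F^×)^p`. [cite: Kuhlmann2010, Lemma 2.10] -/
theorem modPthPowers_one_of_valuation_sub_one_lt {e : Ω} (heF : e ∈ F)
    (he : V.valuation (e - 1) < V.valuation C ^ p) : ModPthPowers F p e 1 := by
  obtain ⟨w, hwF, hw⟩ := exists_pow_eq_one_add_of_valuation_lt V hF hp.out hCF hC hp0 hvp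
    (sub_mem heF F.one_mem) he
  rw [add_sub_cancel] at hw
  have he1 : V.valuation (e - 1) < 1 := he.trans (valuation_C_pow_lt_one V hp.out hC hvp)
  have hw0 : w ≠ 0 := by
    rintro rfl
    rw [zero_pow hp.out.ne_zero] at hw
    exact ne_zero_of_sub_one_lt (V := V) he1 hw.symm
  exact ⟨w, hwF, hw0, by rw [one_mul, hw]⟩

variable (hKF : K ≤ F) (hKroot : ∀ c ∈ K, ∃ d ∈ K, d ^ p = c)

include hKF hKroot in
/-- **Non-zero constants are `p`-th powers**: `K` being closed under `p`-th roots,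
`c ≡ 1 mod (F^×)^p` for `c ∈ K^×` (the step "using our assumption that `K` is closed under
`p`-th roots, we may replace `a` by `b`" of the proof of Prop. 4.13). [cite: Kuhlmann2010, Prop. 4.13 (proof)] -/
theorem modPthPowers_one_of_mem {c : Ω} (hcK : c ∈ K) (hc0 : c ≠ 0) : ModPthPowers F p c 1 := by
  obtain ⟨d, hdK, hd⟩ := hKroot c hcK
  refine ⟨d, hKF hdK, ?_, by rw [one_mul, hd]⟩
  rintro rfl
  rw [zero_pow hp.out.ne_zero] at hd
  exact hc0 hd.symm

end Setting

/-! ### Product representation of `1`-units (the peeling procedure) -/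

namespace IsDenseLiftedFrobeniusClosedBasis

variable {V} {p : ℕ} {K F : Subfield Ω} {B : Set Ω}
variable (h : IsDenseLiftedFrobeniusClosedBasis V p K F B)
include h

omit h in
/-- The product `∏ (1 + g_u u)` over any finite set containing the support. [folklore] -/
theorem prod_eq_prod_of_support_subset (g : B →₀ K) {T : Finset B} (hT : g.support ⊆ T) :
    ∏ u ∈ g.support, (1 + (g u : Ω) * (u : Ω)) = ∏ u ∈ T, (1 + (g u : Ω) * (u : Ω)) := by
  refine Finset.prod_subset hT fun u _ hu => ?_
  rw [Finsupp.notMem_support_iff.mp hu, ZeroMemClass.coe_zero, zero_mul, add_zero]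

omit h in
/-- The linear combination as a sum over any finite set containing the support. [folklore] -/
theorem lc_eq_sum_of_support_subset (g : B →₀ K) {T : Finset B} (hT : g.support ⊆ T) :
    (g.sum fun u c => (c : Ω) * (u : Ω)) = ∑ u ∈ T, (g u : Ω) * (u : Ω) := by
  rw [lc_eq_sum]
  refine Finset.sum_subset hT fun u _ hu => ?_
  rw [Finsupp.notMem_support_iff.mp hu, ZeroMemClass.coe_zero, zero_mul]

/-- The factors `1 + g_u u` are `1`-units when `v(g_u) < 1`: the product is in `F`. [folklore] -/
theorem prod_one_add_mem (g : B →₀ K) (T : Finset B) : ∏ u ∈ T, (1 + (g u : Ω) * (u : Ω)) ∈ F :=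
  _root_.prod_mem fun u _ => add_mem F.one_mem (mul_mem (h.le (g u).2) (h.subset u.2))

/-- The level of the product `∏ (1 + g_u u)`. [folklore] -/
theorem valuation_prod_sub_one_le (g : B →₀ K) (T : Finset B) {γ : V.ValueGroup} (hγ : γ ≤ 1)
    (hg : ∀ u, V.valuation (g u : Ω) ≤ γ) :
    V.valuation (∏ u ∈ T, (1 + (g u : Ω) * (u : Ω)) - 1) ≤ γ := by
  refine valuation_prod_one_add_sub_one_le T (fun u : B => (g u : Ω) * (u : Ω)) hγ fun u _ => ?_
  rw [map_mul, h.valuation_eq_one u u.2, mul_one]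
  exact hg u

/-- The product `∏ (1 + g_u u)` is non-zero when `v(g_u) < 1`. [folklore] -/
theorem prod_ne_zero (g : B →₀ K) (T : Finset B) (hg : ∀ u, V.valuation (g u : Ω) < 1) :
    ∏ u ∈ T, (1 + (g u : Ω) * (u : Ω)) ≠ 0 := by
  refine Finset.prod_ne_zero_iff.mpr fun u _ => ne_zero_of_sub_one_lt (V := V) ?_
  rw [add_sub_cancel_left, map_mul, h.valuation_eq_one u u.2, mul_one]
  exact hg u

/-- **One peeling step.** Given `P_g (1 + t)` with all `v(g_u) ≤ θ < 1`, `0 < v(t) ≤ θ`, and a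
linear combination `lc s` with `v(t - lc s) ≤ v(t)²`, the finitely supported `g' = g + s` has
`P_g (1 + t) = P_{g'} (1 + t')` with `v(t') ≤ θ·v(t)` and all `v(g'_u) ≤ θ`: the merged factors
`(1 + g_u u)(1 + s_u u) = (1 + (g_u + s_u) u)(1 + κ_u)` have `v(κ_u) ≤ θ v(t)`, and
`∏ (1 + s_u u) = 1 + lc s + q` with `v(q) ≤ v(t)²`. [folklore] -/
theorem peel_step {θ : V.ValueGroup} (hθ : θ < 1) (g s : B →₀ K) (hg : ∀ u, V.valuation (g u : Ω) ≤ θ)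
    {t : Ω} (htF : t ∈ F) (ht0 : t ≠ 0) (htθ : V.valuation t ≤ θ)
    (hs : V.valuation (t - s.sum fun u c => (c : Ω) * (u : Ω)) ≤ V.valuation t * V.valuation t) :
    (∀ u, V.valuation ((g + s) u : Ω) ≤ θ) ∧
    ∃ t' ∈ F, V.valuation t' ≤ θ * V.valuation t ∧
      (∏ u ∈ g.support, (1 + (g u : Ω) * (u : Ω))) * (1 + t) =
        (∏ u ∈ (g + s).support, (1 + ((g + s) u : Ω) * (u : Ω))) * (1 + t') := by
  classical
  have hvt0 : 0 < V.valuation t := (Valuation.pos_iff _).mpr ht0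
  have hvt1 : V.valuation t < 1 := htθ.trans_lt hθ
  -- `v(lc s) = v(t)`, so `v(s_u) ≤ v(t)`
  have hlt : V.valuation (t - s.sum fun u c => (c : Ω) * (u : Ω)) < V.valuation t := by
    refine hs.trans_lt ?_
    calc V.valuation t * V.valuation t < V.valuation t * 1 := mul_lt_mul_of_pos_left hvt1 hvt0
      _ = V.valuation t := mul_one _
  have hlcs : V.valuation (s.sum fun u c => (c : Ω) * (u : Ω)) = V.valuation t := by
    have key : (s.sum fun u c => (c : Ω) * (u : Ω)) = t - (t - s.sum fun u c => (c : Ω) * (u : Ω)) := by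
      ring
    rw [key]
    exact Valuation.map_sub_eq_of_lt_left _ hlt
  have hsu : ∀ u, V.valuation (s u : Ω) ≤ V.valuation t := fun u =>
    (h.valuation_coeff_le_valuation_lc s u).trans hlcs.le
  -- the merged coefficients
  have hg' : ∀ u, V.valuation ((g + s) u : Ω) ≤ θ := by
    intro u
    rw [Finsupp.add_apply, Subfield.coe_add]
    exact Valuation.map_add_le _ (hg u) ((hsu u).trans htθ)
  refine ⟨hg', ?_⟩
  -- work over `T = supp g ∪ supp s`
  set T : Finset B := g.support ∪ s.support with hT
  have hgT : g.support ⊆ T := Finset.subset_union_left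
  have hsT : s.support ⊆ T := Finset.subset_union_right
  have hg'T : (g + s).support ⊆ T := Finsupp.support_add
  rw [prod_eq_prod_of_support_subset g hgT, prod_eq_prod_of_support_subset (g + s) hg'T]
  -- the merging corrections `κ_u`
  have hunit : ∀ u : B, 1 + ((g + s) u : Ω) * (u : Ω) ≠ 0 := fun u =>
    ne_zero_of_sub_one_lt (V := V) (by
      rw [add_sub_cancel_left, map_mul, h.valuation_eq_one u u.2, mul_one]
      exact (hg' u).trans_lt hθ)
  set κ : B → Ω := fun u => (g u : Ω) * (s u : Ω) * (u : Ω) ^ 2 / (1 + ((g + s) u : Ω) * (u : Ω)) with hκ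
  have hκval : ∀ u, V.valuation (κ u) ≤ θ * V.valuation t := by
    intro u
    have h1 : V.valuation (1 + ((g + s) u : Ω) * (u : Ω)) = 1 :=
      valuation_eq_one_of_sub_one_lt (V := V) (by
        rw [add_sub_cancel_left, map_mul, h.valuation_eq_one u u.2, mul_one]
        exact (hg' u).trans_lt hθ)
    rw [hκ]
    dsimp only
    rw [map_div₀, h1, div_one, map_mul, map_mul, map_pow, h.valuation_eq_one u u.2, one_pow, mul_one]
    exact mul_le_mul' (hg u) (hsu u)
  have hfactor : ∀ u : B, (1 + (g u : Ω) * (u : Ω)) * (1 + (s u : Ω) * (u : Ω)) =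
      (1 + ((g + s) u : Ω) * (u : Ω)) * (1 + κ u) := by
    intro u
    rw [hκ]
    dsimp only
    rw [mul_add (1 + ((g + s) u : Ω) * (u : Ω)) 1, mul_one, mul_div_cancel₀ _ (hunit u),
      Finsupp.add_apply, Subfield.coe_add]
    ring
  -- products over `T`
  set Pg := ∏ u ∈ T, (1 + (g u : Ω) * (u : Ω)) with hPg
  set Ps := ∏ u ∈ T, (1 + (s u : Ω) * (u : Ω)) with hPs
  set Pg' := ∏ u ∈ T, (1 + ((g + s) u : Ω) * (u : Ω)) with hPg'
  set Kap := ∏ u ∈ T, (1 + κ u) with hKap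
  have hprod : Pg * Ps = Pg' * Kap := by
    rw [hPg, hPs, hPg', hKap, ← Finset.prod_mul_distrib, ← Finset.prod_mul_distrib]
    exact Finset.prod_congr rfl fun u _ => hfactor u
  have hθt1 : θ * V.valuation t ≤ 1 := mul_le_one' hθ.le hvt1.le
  have hKap1 : V.valuation (Kap - 1) ≤ θ * V.valuation t :=
    valuation_prod_one_add_sub_one_le T κ hθt1 fun u _ => hκval u
  -- `Ps = 1 + lc s + q`, `v(q) ≤ v(t)²`
  have hq : V.valuation (Ps - 1 - s.sum fun u c => (c : Ω) * (u : Ω)) ≤ V.valuation t * V.valuation t := by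
    rw [lc_eq_sum_of_support_subset s hsT, hPs]
    refine valuation_prod_one_add_sub_le T (fun u : B => (s u : Ω) * (u : Ω)) hvt1.le fun u _ => ?_
    rw [map_mul, h.valuation_eq_one u u.2, mul_one]
    exact hsu u
  have hPs1 : V.valuation (Ps - 1) < 1 := by
    refine (valuation_prod_one_add_sub_one_le T (fun u : B => (s u : Ω) * (u : Ω)) hvt1.le
      fun u _ => ?_).trans_lt hvt1
    rw [map_mul, h.valuation_eq_one u u.2, mul_one]
    exact hsu u
  have hPs0 : Ps ≠ 0 := ne_zero_of_sub_one_lt (V := V) hPs1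
  have hPsval : V.valuation Ps = 1 := valuation_eq_one_of_sub_one_lt (V := V) hPs1
  -- the new remainder
  refine ⟨Kap * ((1 + t) / Ps) - 1, ?_, ?_, ?_⟩
  · refine sub_mem (mul_mem ?_ (div_mem (add_mem F.one_mem htF) ?_)) F.one_mem
    · exact _root_.prod_mem fun u _ => add_mem F.one_mem (div_mem (mul_mem (mul_mem (h.le (g u).2)
        (h.le (s u).2)) (_root_.pow_mem (h.subset u.2) 2)) (add_mem F.one_mem
        (mul_mem (h.le ((g + s) u).2) (h.subset u.2))))
    · exact _root_.prod_mem fun u _ => add_mem F.one_mem (mul_mem (h.le (s u).2) (h.subset u.2))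
  · -- `v(t') ≤ θ v(t)`
    have hquot : V.valuation ((1 + t) / Ps - 1) ≤ θ * V.valuation t := by
      have key : (1 + t) / Ps - 1 = (t - (s.sum fun u c => (c : Ω) * (u : Ω)) -
          (Ps - 1 - s.sum fun u c => (c : Ω) * (u : Ω))) / Ps := by
        field_simp
        ring
      rw [key, map_div₀, hPsval, div_one]
      refine (Valuation.map_sub_le _ hs hq).trans ?_
      exact mul_le_mul_left htθ _
    exact valuation_mul_sub_one_le hKap1 hquot hθt1
  · -- the product identity
    have hPg0 : Pg' ≠ 0 := h.prod_ne_zero (g + s) T fun u => (hg' u).trans_lt hθ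
    rw [show Pg' * (1 + (Kap * ((1 + t) / Ps) - 1)) = (Pg' * Kap) * (1 + t) / Ps by ring, ← hprod]
    field_simp

/-- **Product representation of `1`-units (Kuhlmann 2010, proof of Prop. 4.13: "In view of
Lemma 4.9 and part a) of Corollary 2.11, we may further assume that `u = 1 + ∑ cᵢuᵢ` …"; here in
PRODUCT form).** For `(F, v)` of rank one and a `1`-unit `w ∈ F`, and any `ε ∈ F^×`, there is a
finitely supported family of coefficients `g : B →₀ K`, all of value `≤ v(w - 1)`, with
`w = ∏_{u} (1 + g_u u) · (1 + t)`, `v(t) < v(ε)`. PROVED by iterating `peel_step` (each step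
multiplies the level of the remainder by `θ = v(w - 1) < 1`; the value group of `F` being
archimedean, finitely many steps reach `v(ε)`). [cite: Kuhlmann2010, Prop. 4.13 (proof) and Lemma 4.9] -/
theorem exists_prod_mul_one_add (hrank : IsRankOneValued V F) {w : Ω} (hwF : w ∈ F)
    (hw : V.valuation (w - 1) < 1) {ε : Ω} (hεF : ε ∈ F) (hε0 : ε ≠ 0) :
    ∃ g : B →₀ K, (∀ u, V.valuation (g u : Ω) ≤ V.valuation (w - 1)) ∧
      ∃ t ∈ F, V.valuation t < V.valuation ε ∧
        w = (∏ u ∈ g.support, (1 + (g u : Ω) * (u : Ω))) * (1 + t) := by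
  classical
  have hvε : 0 < V.valuation ε := (Valuation.pos_iff _).mpr hε0
  by_cases hw0 : w - 1 = 0
  · refine ⟨0, fun u => ?_, 0, F.zero_mem, by rwa [map_zero], ?_⟩
    · rw [Finsupp.coe_zero, Pi.zero_apply, ZeroMemClass.coe_zero, map_zero]
      exact zero_le
    · rw [Finsupp.support_zero, Finset.prod_empty, add_zero, mul_one]
      exact (sub_eq_zero.mp hw0)
  set θ := V.valuation (w - 1) with hθ
  have hθ0 : 0 < θ := (Valuation.pos_iff _).mpr hw0
  -- the iteration
  have iter : ∀ n : ℕ, ∃ g : B →₀ K, (∀ u, V.valuation (g u : Ω) ≤ θ) ∧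
      ∃ t ∈ F, V.valuation t ≤ θ ^ (n + 1) ∧
        w = (∏ u ∈ g.support, (1 + (g u : Ω) * (u : Ω))) * (1 + t) := by
    intro n
    induction n with
    | zero =>
      refine ⟨0, fun u => ?_, w - 1, sub_mem hwF F.one_mem, by rw [zero_add, pow_one], ?_⟩
      · rw [Finsupp.coe_zero, Pi.zero_apply, ZeroMemClass.coe_zero, map_zero]
        exact zero_le
      · rw [Finsupp.support_zero, Finset.prod_empty, one_mul, add_sub_cancel]
    | succ n ih =>
      obtain ⟨g, hg, t, htF, htn, hw'⟩ := ih
      by_cases ht0 : t = 0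
      · refine ⟨g, hg, t, htF, ?_, hw'⟩
        rw [ht0, map_zero]
        exact zero_le
      -- approximate `t` to within `v(t)²`
      obtain ⟨s, hs⟩ := h.dense t htF (t * t) (mul_mem htF htF) (mul_ne_zero ht0 ht0)
      rw [map_mul] at hs
      have htθ : V.valuation t ≤ θ := htn.trans (pow_le_of_le_one hθ0.le hw.le (Nat.succ_ne_zero n))
      obtain ⟨hg', t', ht'F, ht', heq⟩ := h.peel_step hw g s hg htF ht0 htθ hs.le
      refine ⟨g + s, hg', t', ht'F, ?_, by rw [← heq, ← hw']⟩
      calc V.valuation t' ≤ θ * V.valuation t := ht'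
        _ ≤ θ * θ ^ (n + 1) := mul_le_mul_right htn _
        _ = θ ^ (n + 1 + 1) := by rw [pow_succ _ (n + 1), mul_comm]
  -- the value group of `F` is archimedean: `θ^n ≤ v(ε)·θ < v(ε)` for some `n`
  have ha : 1 < V.valuation (w - 1)⁻¹ := by
    rw [map_inv₀]
    exact one_lt_inv₀ hθ0 |>.mpr hw
  obtain ⟨n, hn⟩ := hrank.2 (w - 1)⁻¹ (F.inv_mem (sub_mem hwF F.one_mem)) (ε * (w - 1))⁻¹
    (F.inv_mem (mul_mem hεF (sub_mem hwF F.one_mem))) ha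
  rw [map_inv₀, map_inv₀, map_mul, ← hθ, inv_pow, inv_le_inv₀ (mul_pos hvε hθ0) (pow_pos hθ0 n)] at hn
  obtain ⟨g, hg, t, htF, htn, hw'⟩ := iter n
  refine ⟨g, hg, t, htF, ?_, hw'⟩
  calc V.valuation t ≤ θ ^ (n + 1) := htn
    _ = θ ^ n * θ := pow_succ θ n
    _ ≤ V.valuation ε * θ * θ := mul_le_mul_left hn θ
    _ = V.valuation ε * (θ * θ) := mul_assoc _ _ _
    _ < V.valuation ε * 1 :=
        mul_lt_mul_of_pos_left (lt_of_le_of_lt (mul_le_of_le_one_right' hw.le) hw) hvε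
    _ = V.valuation ε := mul_one _

end IsDenseLiftedFrobeniusClosedBasis

/-! ### Conversion of `p`-th power factors -/

section Conversion

variable {V} {p : ℕ} [hp : Fact p.Prime] {F : Subfield Ω}

/-- **Merging two binomial factors**: `(1 + a u)(1 + b u) = (1 + (a + b) u)(1 + κ)` with
`κ = a b u² / (1 + (a + b) u)`. [folklore] -/
theorem one_add_mul_mul_one_add_mul (a b u : Ω) (h0 : 1 + (a + b) * u ≠ 0) :
    (1 + a * u) * (1 + b * u) = (1 + (a + b) * u) * (1 + a * b * u ^ 2 / (1 + (a + b) * u)) := by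
  rw [mul_add (1 + (a + b) * u) 1, mul_one, mul_div_cancel₀ _ h0]
  ring

/-- **The phase-one conversion** (Kuhlmann 2010, proof of Prop. 4.6: "we replace `u` by
`u' := u/(1 + ∑ zⱼ)^{p^ν}` … the first quotient … is equivalent to `1` modulo `p𝓜_F`"): for
`v(c) < 1`, `1 + c^p = (1 + c)^p · ρ` with `v(ρ - 1) ≤ v(p)·v(c)` — by the binomial expansion
`(1 + c)^p = 1 + c^p + p c S`, `v(S) ≤ 1`. [cite: Kuhlmann2010, Prop. 4.6 (proof)] -/
theorem exists_one_add_pow_eq_mul {c : Ω} (hcF : c ∈ F) (hc : V.valuation c < 1) :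
    ∃ ρ ∈ F, 1 + c ^ p = (1 + c) ^ p * ρ ∧ V.valuation (ρ - 1) ≤ V.valuation (p : Ω) * V.valuation c := by
  classical
  have hnatV : ∀ n : ℕ, V.valuation (n : Ω) ≤ 1 := fun n =>
    V.valuation_le_one_iff _ |>.mpr (natCast_mem V n)
  set S : Ω := ∑ k ∈ Finset.Ioo 0 p, c ^ (k - 1) * (1 : Ω) ^ (p - k - 1) * ((p.choose k / p : ℕ) : Ω)
    with hS
  have hexp : (1 + c) ^ p = (1 + c ^ p) + p * c * S := by
    rw [add_comm 1 c, add_pow_prime_eq hp.out c 1, one_pow, mul_one, hS]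
    ring
  have hSval : V.valuation S ≤ 1 := by
    refine Valuation.map_sum_le _ fun k _ => ?_
    rw [one_pow, mul_one, map_mul, map_pow]
    exact mul_le_one' (pow_le_one₀ zero_le hc.le) (hnatV _)
  have hSF : S ∈ F := sum_mem fun k _ =>
    mul_mem (mul_mem (pow_mem hcF _) (pow_mem F.one_mem _)) (natCast_mem F _)
  have h1c : V.valuation (1 + c) = 1 := by
    rw [add_comm]
    exact valuation_eq_one_of_sub_one_lt (V := V) (by rwa [add_sub_cancel_right])
  have h1c0 : (1 + c) ^ p ≠ 0 := pow_ne_zero _ fun h0 => by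
    rw [h0, map_zero] at h1c; exact zero_ne_one h1c
  refine ⟨(1 + c ^ p) / (1 + c) ^ p, div_mem (add_mem F.one_mem (pow_mem hcF p))
    (pow_mem (add_mem F.one_mem hcF) p), by rw [mul_div_cancel₀ _ h1c0], ?_⟩
  have key : (1 + c ^ p) / (1 + c) ^ p - 1 = -(p * c * S) / (1 + c) ^ p := by
    rw [div_sub_one h1c0, hexp]
    ring
  rw [key, map_div₀, Valuation.map_neg, map_pow, h1c, one_pow, div_one, map_mul, map_mul]
  calc V.valuation (p : Ω) * V.valuation c * V.valuation S ≤ V.valuation (p : Ω) * V.valuation c * 1 :=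
        mul_le_mul_right hSval _
    _ = V.valuation (p : Ω) * V.valuation c := mul_one _

variable (hF : IsHenselianField F (V.comap (algebraMap F Ω)))
  {C : Ω} (hCF : C ∈ F) (hC : C ^ (p - 1) = -(p : Ω)) (hp0 : (p : Ω) ≠ 0)
  (hvp : V.valuation (p : Ω) < 1)
include hF hCF hC hp0 hvp

/-- **The phase-two conversion** (Kuhlmann 2010, Cor. 2.11 d) with `b = 0`, as used in the
proof of Prop. 4.6: "we may replace every monomial of the form `cᵢxⁱ` with `i ∈ pℤ` by the
monomial `-pc̃ᵢx^{i/p}`"): for `c ∈ F` with `v(c)^p < v(p)`, `1 - p c ≡ 1 + c^p mod (F^×)^p`.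
[cite: Kuhlmann2010, Cor. 2.11 d) and Prop. 4.6 (proof)] -/
theorem modPthPowers_one_sub_mul_one_add_pow {c : Ω} (hcF : c ∈ F)
    (hc : V.valuation c ^ p < V.valuation (p : Ω)) :
    ModPthPowers F p (1 - p * c) (1 + c ^ p) := by
  obtain ⟨w, hwF, hw0, hw⟩ := exists_sub_mul_eq_mul_pow V hF hp.out hCF hC hp0 hvp F.zero_mem hcF
    (by rw [map_zero]; exact zero_le) hc
  exact ⟨w, hwF, hw0, by simpa using hw⟩

end Conversion

namespace IsDenseLiftedFrobeniusClosedBasis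

variable {V} {p : ℕ} [hp : Fact p.Prime] {K F : Subfield Ω} {B : Set Ω}
variable (h : IsDenseLiftedFrobeniusClosedBasis V p K F B)
variable (hF : IsHenselianField F (V.comap (algebraMap F Ω)))
  {C : Ω} (hCF : C ∈ F) (hC : C ^ (p - 1) = -(p : Ω)) (hp0 : (p : Ω) ≠ 0)
  (hvp : V.valuation (p : Ω) < 1)
include h

/-! ### Merging product representations -/

include hF hCF hC hp0 hvp in
/-- **Merging two product representations**: if `v(a_u)·v(b_u) < v(C)^p` for all `u` (and all
coefficients have value `< 1`), then `P_a · P_b ≡ P_{a+b} mod (F^×)^p` — the merging corrections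
`1 + a_u b_u u²/(1 + (a_u + b_u) u)` are `1`-units of level `> λ`, hence `p`-th powers
(Lemma 2.10). [cite: Kuhlmann2010, Lemma 2.10 and Cor. 2.11 a)] -/
theorem modPthPowers_prod_mul_prod (a b : B →₀ K) (ha : ∀ u, V.valuation (a u : Ω) < 1)
    (hb : ∀ u, V.valuation (b u : Ω) < 1)
    (hab : ∀ u, V.valuation (a u : Ω) * V.valuation (b u : Ω) < V.valuation C ^ p) :
    ModPthPowers F p
      ((∏ u ∈ a.support, (1 + (a u : Ω) * (u : Ω))) * ∏ u ∈ b.support, (1 + (b u : Ω) * (u : Ω)))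
      (∏ u ∈ (a + b).support, (1 + ((a + b) u : Ω) * (u : Ω))) := by
  classical
  have hΛ1 : V.valuation C ^ p < 1 := valuation_C_pow_lt_one V hp.out hC hvp
  set T : Finset B := a.support ∪ b.support with hT
  rw [prod_eq_prod_of_support_subset a (Finset.subset_union_left (s₂ := b.support)),
    prod_eq_prod_of_support_subset b (Finset.subset_union_right (s₁ := a.support)),
    prod_eq_prod_of_support_subset (a + b) (Finsupp.support_add), ← hT, ← Finset.prod_mul_distrib]
  -- the merged coefficients are `1`-units
  have hab1 : ∀ u : B, V.valuation ((a + b) u : Ω) < 1 := fun u => by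
    rw [Finsupp.add_apply, Subfield.coe_add]
    exact Valuation.map_add_lt _ (ha u) (hb u)
  have hunit : ∀ u : B, 1 + ((a u : Ω) + (b u : Ω)) * (u : Ω) ≠ 0 := fun u =>
    ne_zero_of_sub_one_lt (V := V) (by
      rw [add_sub_cancel_left, map_mul, h.valuation_eq_one u u.2, mul_one, ← Subfield.coe_add,
        ← Finsupp.add_apply]
      exact hab1 u)
  have hfac : ∀ u : B, (1 + (a u : Ω) * (u : Ω)) * (1 + (b u : Ω) * (u : Ω)) =
      (1 + ((a + b) u : Ω) * (u : Ω)) *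
        (1 + (a u : Ω) * (b u : Ω) * (u : Ω) ^ 2 / (1 + ((a u : Ω) + (b u : Ω)) * (u : Ω))) := by
    intro u
    rw [one_add_mul_mul_one_add_mul _ _ _ (hunit u), Finsupp.add_apply, Subfield.coe_add]
  rw [Finset.prod_congr rfl fun u _ => hfac u, Finset.prod_mul_distrib]
  -- each correction is `≡ 1`
  have hcorr : ∀ u : B, ModPthPowers F p
      (1 + (a u : Ω) * (b u : Ω) * (u : Ω) ^ 2 / (1 + ((a u : Ω) + (b u : Ω)) * (u : Ω))) 1 := by
    intro u
    refine modPthPowers_one_of_valuation_sub_one_lt hF hCF hC hp0 hvp ?_ ?_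
    · exact add_mem F.one_mem (div_mem (mul_mem (mul_mem (h.le (a u).2) (h.le (b u).2))
        (_root_.pow_mem (h.subset u.2) 2)) (add_mem F.one_mem (mul_mem (add_mem (h.le (a u).2)
        (h.le (b u).2)) (h.subset u.2))))
    · have h1 : V.valuation (1 + ((a u : Ω) + (b u : Ω)) * (u : Ω)) = 1 :=
        valuation_eq_one_of_sub_one_lt (V := V) (by
          rw [add_sub_cancel_left, map_mul, h.valuation_eq_one u u.2, mul_one, ← Subfield.coe_add,
            ← Finsupp.add_apply]
          exact hab1 u)
      rw [add_sub_cancel_left, map_div₀, h1, div_one, map_mul, map_mul, map_pow,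
        h.valuation_eq_one u u.2, one_pow, mul_one]
      exact hab u
  have := (ModPthPowers.refl (F := F) (p := p) (∏ u ∈ T, (1 + ((a + b) u : Ω) * (u : Ω)))).mul
    (ModPthPowers.prod T fun u _ => hcorr u)
  rwa [Finset.prod_const_one, mul_one] at this

/-! ### Heights in `B` -/

omit h hp in
/-- Height bounds are monotone: if no `w ∈ B` has `w^{p^n} = u` then none has `w^{p^m} = u` for
`m ≥ n` (`B` is closed under `p`-th powers). [folklore] -/
theorem pow_pow_ne_of_le (hB : ∀ u ∈ B, u ^ p ∈ B) {u : Ω} {n m : ℕ} (hnm : n ≤ m)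
    (hu : ∀ w ∈ B, w ^ p ^ n ≠ u) : ∀ w ∈ B, w ^ p ^ m ≠ u := by
  intro w hw heq
  obtain ⟨k, rfl⟩ := Nat.exists_eq_add_of_le hnm
  have hwk : ∀ j : ℕ, w ^ p ^ j ∈ B := fun j => by
    induction j with
    | zero => simpa using hw
    | succ j ih =>
      rw [pow_succ, pow_mul]
      exact hB _ ih
  refine hu (w ^ p ^ k) (hwk k) ?_
  rw [← pow_mul, ← pow_add, add_comm]
  exact heq

omit h hp in
/-- An element of `B` without `p`-th root in `B` satisfies every height bound `n ≥ 1`. [folklore] -/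
theorem pow_pow_ne_of_no_root (hB : ∀ u ∈ B, u ^ p ∈ B) {u : Ω} (hu : ∀ w ∈ B, w ^ p ≠ u) {n : ℕ}
    (hn : 1 ≤ n) : ∀ w ∈ B, w ^ p ^ n ≠ u := by
  refine pow_pow_ne_of_le hB hn fun w hw => ?_
  rw [pow_one]
  exact hu w hw

omit h hp in
/-- A `p`-th root lowers the height bound by one. [folklore] -/
theorem pow_pow_ne_root {u r : Ω} {n : ℕ} (hu : ∀ w ∈ B, w ^ p ^ (n + 1) ≠ u) (hr : r ^ p = u) :
    ∀ w ∈ B, w ^ p ^ n ≠ r := by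
  intro w hw heq
  refine hu w hw ?_
  rw [pow_succ, pow_mul, heq, hr]

/-! ### Phase two: conversion of all `p`-th power factors of level `> vp` -/

omit h in
/-- `v(x)·v(y) < v(C)^p` for `v(x), v(y) < v(p)` (as `v(p) ≤ v(C)`, `v(C)^p = v(p)v(C)`). [folklore] -/
theorem mul_lt_valuation_C_pow {C : Ω} (hC : C ^ (p - 1) = -(p : Ω)) (hvp : V.valuation (p : Ω) < 1)
    (hp0 : (p : Ω) ≠ 0) {x y : V.ValueGroup} (hx : x < V.valuation (p : Ω)) (hy : y < V.valuation (p : Ω)) :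
    x * y < V.valuation C ^ p := by
  have hP0 : 0 < V.valuation (p : Ω) := (Valuation.pos_iff _).mpr hp0
  rw [valuation_C_pow V hp.out hC]
  calc x * y ≤ x * V.valuation (p : Ω) := mul_le_mul_right hy.le _
    _ < V.valuation (p : Ω) * V.valuation (p : Ω) := mul_lt_mul_of_pos_right hx hP0
    _ ≤ V.valuation (p : Ω) * V.valuation C :=
        mul_le_mul_right (valuation_p_le_valuation_C V hp.out hC hvp) _

omit h hp in
/-- The product representation of a single binomial factor. [folklore] -/
theorem prod_single (u : B) {c : K} (hc : c ≠ 0) :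
    ∏ w ∈ (Finsupp.single u c).support, (1 + ((Finsupp.single u c) w : Ω) * (w : Ω)) =
      1 + (c : Ω) * (u : Ω) := by
  rw [Finsupp.support_single _ hc, Finset.prod_singleton, Finsupp.single_eq_same]

variable (hKroot : ∀ c ∈ K, ∃ d ∈ K, d ^ p = c)

include hF hCF hC hp0 hvp hKroot in
/-- **Phase two of the normal form** (Kuhlmann 2010, proof of Prop. 4.6, as invoked in the proof
of Prop. 4.13: "we may replace every monomial … with `i ∈ pℤ` by the monomial `-pc̃ᵢx^{i/p}` …
After an iterated application we may then assume in addition that `I ∩ pℤ = ∅`"). In product form: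
a product `P_h = ∏ (1 + h_u u)` all of whose coefficients have value `< v(p)` (level `> vp`) is
congruent modulo `(F^×)^p` to a product `P_{h'}` of the same kind in which no `u ≠ 1` of the
support is a `p`-th power in `B`. PROVED by induction on a height bound for the support
(`finite_height`), converting one factor `1 + d^p r^p ≡ 1 - p d r` at a time (Cor. 2.11 d)) and
merging (`modPthPowers_prod_mul_prod`; the merging corrections have level `> 2vp ≥ (p/(p-1))vp`).
[cite: Kuhlmann2010, Prop. 4.6 (proof), Cor. 2.11 d) and Prop. 4.13 (proof)] -/
theorem phase_two (N : ℕ) :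
    ∀ hh : B →₀ K, (∀ u ∈ hh.support, ((u : B) : Ω) ≠ 1 → ∀ w ∈ B, w ^ p ^ N ≠ (u : Ω)) →
      (∀ u, V.valuation (hh u : Ω) < V.valuation (p : Ω)) →
      ∃ h' : B →₀ K, (∀ u ∈ h'.support, ((u : B) : Ω) ≠ 1 → ∀ w ∈ B, w ^ p ≠ (u : Ω)) ∧
        (∀ u, V.valuation (h' u : Ω) < V.valuation (p : Ω)) ∧
        ModPthPowers F p (∏ u ∈ hh.support, (1 + (hh u : Ω) * (u : Ω)))
          (∏ u ∈ h'.support, (1 + (h' u : Ω) * (u : Ω))) := by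
  classical
  have hP1 : V.valuation (p : Ω) < 1 := hvp
  induction N with
  | zero =>
    -- no `u ≠ 1` in the support
    intro hh hN hval
    refine ⟨hh, fun u hu hu1 w hw heq => ?_, hval, ModPthPowers.refl _⟩
    exact hN u hu hu1 u u.2 (by rw [pow_zero, pow_one])
  | succ n ih =>
    intro hh hN hval
    by_cases hn0 : n = 0
    · subst hn0
      refine ⟨hh, fun u hu hu1 w hw => ?_, hval, ModPthPowers.refl _⟩
      have := hN u hu hu1 w hw
      rwa [zero_add, pow_one] at this
    have hn1 : 1 ≤ n := Nat.one_le_iff_ne_zero.mpr hn0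
    -- inner induction on the number of support elements still to be converted at this level
    set bad : (B →₀ K) → Finset B := fun f => f.support.filter fun u =>
      ((u : B) : Ω) ≠ 1 ∧ (∃ w ∈ B, w ^ p = (u : Ω)) ∧ ¬ ∀ w ∈ B, w ^ p ^ n ≠ (u : Ω) with hbad
    have hmem_bad : ∀ (f : B →₀ K) (u : B), u ∈ bad f ↔ u ∈ f.support ∧
        ((u : B) : Ω) ≠ 1 ∧ (∃ w ∈ B, w ^ p = (u : Ω)) ∧ ¬ ∀ w ∈ B, w ^ p ^ n ≠ (u : Ω) := by
      intro f u
      rw [hbad, Finset.mem_filter]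
    suffices inner : ∀ (k : ℕ) (f : B →₀ K),
        (∀ u ∈ f.support, ((u : B) : Ω) ≠ 1 → ∀ w ∈ B, w ^ p ^ (n + 1) ≠ (u : Ω)) →
        (∀ u, V.valuation (f u : Ω) < V.valuation (p : Ω)) → (bad f).card ≤ k →
        ∃ h' : B →₀ K, (∀ u ∈ h'.support, ((u : B) : Ω) ≠ 1 → ∀ w ∈ B, w ^ p ≠ (u : Ω)) ∧
          (∀ u, V.valuation (h' u : Ω) < V.valuation (p : Ω)) ∧
          ModPthPowers F p (∏ u ∈ f.support, (1 + (f u : Ω) * (u : Ω)))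
            (∏ u ∈ h'.support, (1 + (h' u : Ω) * (u : Ω))) from
      inner _ hh hN hval le_rfl
    intro k
    induction k with
    | zero =>
      intro f hNf hvalf hcard
      -- nothing to convert: every `u ≠ 1` satisfies the bound `n`
      refine ih f (fun u hu hu1 => ?_) hvalf
      by_cases hroot : ∃ w ∈ B, w ^ p = (u : Ω)
      · by_contra hnot
        have : u ∈ bad f := (hmem_bad f u).mpr ⟨hu, hu1, hroot, hnot⟩
        rw [Nat.le_zero, Finset.card_eq_zero] at hcard
        rw [hcard] at this
        exact Finset.notMem_empty u this
      · push Not at hroot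
        exact pow_pow_ne_of_no_root h.pow_mem hroot hn1
    | succ k ihk =>
      intro f hNf hvalf hcard
      by_cases hempty : bad f = ∅
      · exact ihk f hNf hvalf (by rw [hempty, Finset.card_empty]; exact Nat.zero_le _)
      obtain ⟨u₀, hu₀⟩ := Finset.nonempty_iff_ne_empty.mpr hempty
      obtain ⟨hu₀f, hu₀1, ⟨r, hrB, hr⟩, -⟩ := (hmem_bad f u₀).mp hu₀
      -- the data of the conversion
      obtain ⟨d, hdK, hd⟩ := hKroot (f u₀ : Ω) (f u₀).2
      have hfu₀ : (f u₀ : Ω) ≠ 0 := fun h0 => (Finsupp.mem_support_iff.mp hu₀f) (Subtype.ext h0)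
      have hd0 : d ≠ 0 := by
        rintro rfl
        rw [zero_pow hp.out.ne_zero] at hd
        exact hfu₀ hd.symm
      have hvd : V.valuation d < 1 := by
        by_contra hle
        push Not at hle
        have : (1 : V.ValueGroup) ≤ V.valuation (f u₀ : Ω) := by
          rw [← hd, map_pow]
          exact one_le_pow₀ hle
        exact not_lt.mpr this ((hvalf u₀).trans hP1)
      set R : B := ⟨r, hrB⟩ with hR
      set c' : K := -((p : K) * ⟨d, hdK⟩) with hc'
      have hc'Ω : (c' : Ω) = -(p * d) := by rw [hc']; push_cast; ring
      have hc'0 : c' ≠ 0 := by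
        intro h0
        have : (c' : Ω) = 0 := by rw [h0]; rfl
        rw [hc'Ω, neg_eq_zero] at this
        exact mul_ne_zero hp0 hd0 this
      have hvc' : V.valuation (c' : Ω) < V.valuation (p : Ω) := by
        rw [hc'Ω, Valuation.map_neg, map_mul]
        calc V.valuation (p : Ω) * V.valuation d < V.valuation (p : Ω) * 1 :=
              mul_lt_mul_of_pos_left hvd ((Valuation.pos_iff _).mpr hp0)
          _ = V.valuation (p : Ω) := mul_one _
      -- the new family
      set f₁ : B →₀ K := f.erase u₀ + Finsupp.single R c' with hf₁
      have herase : ∀ u, V.valuation ((f.erase u₀) u : Ω) < V.valuation (p : Ω) := by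
        intro u
        by_cases hu : u = u₀
        · rw [hu, Finsupp.erase_same, ZeroMemClass.coe_zero, map_zero]
          exact (Valuation.pos_iff _).mpr hp0
        · rw [Finsupp.erase_ne hu]
          exact hvalf u
      have hsingle : ∀ u, V.valuation ((Finsupp.single R c') u : Ω) < V.valuation (p : Ω) := by
        intro u
        by_cases hu : u = R
        · rw [hu, Finsupp.single_eq_same]
          exact hvc'
        · rw [Finsupp.single_eq_of_ne hu, ZeroMemClass.coe_zero, map_zero]
          exact (Valuation.pos_iff _).mpr hp0
      have hval₁ : ∀ u, V.valuation (f₁ u : Ω) < V.valuation (p : Ω) := by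
        intro u
        rw [hf₁, Finsupp.add_apply, Subfield.coe_add]
        exact Valuation.map_add_lt _ (herase u) (hsingle u)
      have hRbound : ∀ w ∈ B, w ^ p ^ n ≠ (R : Ω) :=
        pow_pow_ne_root (hNf u₀ hu₀f hu₀1) hr
      have hsupp₁ : ∀ u ∈ f₁.support, u = R ∨ (u ≠ u₀ ∧ u ∈ f.support) := by
        intro u hu
        by_cases huR : u = R
        · exact Or.inl huR
        · right
          have hu' : u ∈ (f.erase u₀).support := by
            have := Finsupp.support_add hu
            rcases Finset.mem_union.mp this with h1 | h1
            · exact h1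
            · exact absurd (Finset.mem_singleton.mp (Finsupp.support_single_subset h1)) huR
          rw [Finsupp.support_erase] at hu'
          exact ⟨Finset.ne_of_mem_erase hu', Finset.mem_of_mem_erase hu'⟩
      have hN₁ : ∀ u ∈ f₁.support, ((u : B) : Ω) ≠ 1 → ∀ w ∈ B, w ^ p ^ (n + 1) ≠ (u : Ω) := by
        intro u hu hu1
        rcases hsupp₁ u hu with rfl | ⟨-, huf⟩
        · exact pow_pow_ne_of_le h.pow_mem (Nat.le_succ n) hRbound
        · exact hNf u huf hu1
      have hcard₁ : (bad f₁).card ≤ k := by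
        have hsub : bad f₁ ⊆ (bad f).erase u₀ := by
          intro u hu
          obtain ⟨huf₁, hu1, hroot, hnb⟩ := (hmem_bad f₁ u).mp hu
          rcases hsupp₁ u huf₁ with rfl | ⟨hne, huf⟩
          · exact absurd hRbound hnb
          · exact Finset.mem_erase.mpr ⟨hne, (hmem_bad f u).mpr ⟨huf, hu1, hroot, hnb⟩⟩
        calc (bad f₁).card ≤ ((bad f).erase u₀).card := Finset.card_le_card hsub
          _ = (bad f).card - 1 := Finset.card_erase_of_mem hu₀
          _ ≤ k := by omega
      obtain ⟨h', hh'1, hh'2, hh'3⟩ := ihk f₁ hN₁ hval₁ hcard₁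
      refine ⟨h', hh'1, hh'2, ModPthPowers.trans ?_ hh'3⟩
      -- `P_f ≡ P_{f.erase u₀} · (1 + c u₀) ≡ P_{f.erase u₀} · (1 - p d r) ≡ P_{f₁}`
      have hval1 : ∀ u, V.valuation (f u : Ω) < 1 := fun u => (hvalf u).trans hP1
      have step1 : ModPthPowers F p (∏ u ∈ f.support, (1 + (f u : Ω) * (u : Ω)))
          ((∏ u ∈ (f.erase u₀).support, (1 + ((f.erase u₀) u : Ω) * (u : Ω))) *
            ∏ u ∈ (Finsupp.single u₀ (f u₀)).support,
              (1 + ((Finsupp.single u₀ (f u₀)) u : Ω) * (u : Ω))) := by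
        have hm := h.modPthPowers_prod_mul_prod hF hCF hC hp0 hvp (f.erase u₀) (Finsupp.single u₀ (f u₀))
          (fun u => (herase u).trans hP1) (fun u => ?_) (fun u => ?_)
        · rw [Finsupp.erase_add_single] at hm
          exact hm.symm
        · by_cases hu : u = u₀
          · rw [hu, Finsupp.single_eq_same]; exact hval1 u₀
          · rw [Finsupp.single_eq_of_ne hu, ZeroMemClass.coe_zero, map_zero]; exact one_pos
        · by_cases hu : u = u₀
          · rw [hu, Finsupp.erase_same, ZeroMemClass.coe_zero, map_zero, zero_mul]
            exact pow_pos ((Valuation.pos_iff _).mpr (C_ne_zero hp.out hC hp0)) _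
          · rw [Finsupp.single_eq_of_ne hu, ZeroMemClass.coe_zero, map_zero, mul_zero]
            exact pow_pos ((Valuation.pos_iff _).mpr (C_ne_zero hp.out hC hp0)) _
      have step2 : ModPthPowers F p
          (∏ u ∈ (Finsupp.single u₀ (f u₀)).support, (1 + ((Finsupp.single u₀ (f u₀)) u : Ω) * (u : Ω)))
          (∏ u ∈ (Finsupp.single R c').support, (1 + ((Finsupp.single R c') u : Ω) * (u : Ω))) := by
        rw [prod_single u₀ (fun h0 => hfu₀ (by rw [h0]; rfl)), prod_single R hc'0, hc'Ω]
        have key : (f u₀ : Ω) * (u₀ : Ω) = (d * r) ^ p := by rw [mul_pow, hd, hr]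
        rw [key, show 1 + -(↑p * d) * r = 1 - p * (d * r) by ring]
        exact (modPthPowers_one_sub_mul_one_add_pow hF hCF hC hp0 hvp (mul_mem (h.le hdK) (h.subset hrB))
          (by rw [← map_pow, ← key, map_mul, h.valuation_eq_one u₀ u₀.2, mul_one]; exact hvalf u₀)).symm
      have step3 : ModPthPowers F p
          ((∏ u ∈ (f.erase u₀).support, (1 + ((f.erase u₀) u : Ω) * (u : Ω))) *
            ∏ u ∈ (Finsupp.single R c').support, (1 + ((Finsupp.single R c') u : Ω) * (u : Ω)))
          (∏ u ∈ f₁.support, (1 + (f₁ u : Ω) * (u : Ω))) :=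
        h.modPthPowers_prod_mul_prod hF hCF hC hp0 hvp (f.erase u₀) (Finsupp.single R c')
          (fun u => (herase u).trans hP1) (fun u => (hsingle u).trans hP1)
          (fun u => mul_lt_valuation_C_pow hC hvp hp0 (herase u) (hsingle u))
      exact step1.trans ((step2.mul_left _).trans step3)

/-! ### Splitting product representations along a predicate -/

include hF hCF hC hp0 hvp in
/-- Splitting a product representation along a predicate on `B`:
`P_f ≡ P_{f|P} · P_{f|¬P} mod (F^×)^p` (indeed equality; obtained from the merging lemma, the
two parts having disjoint supports). [folklore] -/
theorem modPthPowers_prod_filter (f : B →₀ K) (hf : ∀ u, V.valuation (f u : Ω) < 1) (P : B → Prop)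
    [DecidablePred P] :
    ModPthPowers F p (∏ u ∈ f.support, (1 + (f u : Ω) * (u : Ω)))
      ((∏ u ∈ (f.filter P).support, (1 + ((f.filter P) u : Ω) * (u : Ω))) *
        ∏ u ∈ (f.filter fun u => ¬P u).support, (1 + ((f.filter fun u => ¬P u) u : Ω) * (u : Ω))) := by
  have hC0 : 0 < V.valuation C ^ p := pow_pos ((Valuation.pos_iff _).mpr (C_ne_zero hp.out hC hp0)) _
  have h1 : ∀ u, V.valuation ((f.filter P) u : Ω) < 1 := fun u => by
    rw [Finsupp.filter_apply]
    split_ifs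
    · exact hf u
    · rw [ZeroMemClass.coe_zero, map_zero]; exact one_pos
  have h2 : ∀ u, V.valuation ((f.filter fun u => ¬P u) u : Ω) < 1 := fun u => by
    rw [Finsupp.filter_apply]
    by_cases hu : P u
    · rw [if_neg (not_not.mpr hu), ZeroMemClass.coe_zero, map_zero]; exact one_pos
    · rw [if_pos hu]; exact hf u
  have hm := h.modPthPowers_prod_mul_prod hF hCF hC hp0 hvp (f.filter P) (f.filter fun u => ¬P u) h1 h2
    (fun u => by
      rw [Finsupp.filter_apply, Finsupp.filter_apply]
      by_cases hu : P u
      · rw [if_pos hu, if_neg (not_not.mpr hu), ZeroMemClass.coe_zero, map_zero, mul_zero]; exact hC0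
      · rw [if_neg hu, ZeroMemClass.coe_zero, map_zero, zero_mul]; exact hC0)
  rw [Finsupp.filter_add_filter_not] at hm
  exact hm.symm

omit h in
/-- A product of `1`-units of level `< γ` (`0 < γ ≤ 1`) is a `1`-unit of level `< γ`. [folklore] -/
theorem valuation_prod_sub_one_lt {ι : Type*} (s : Finset ι) (x : ι → Ω) {γ : V.ValueGroup}
    (hγ0 : 0 < γ) (hγ : γ ≤ 1) (hx : ∀ i ∈ s, V.valuation (x i - 1) < γ) :
    V.valuation (∏ i ∈ s, x i - 1) < γ := by
  classical
  induction s using Finset.induction_on with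
  | empty => simpa using hγ0
  | insert i s hi ih =>
    rw [Finset.prod_insert hi]
    exact valuation_mul_sub_one_lt (hx i (Finset.mem_insert_self i s))
      (ih fun j hj => hx j (Finset.mem_insert_of_mem hj)) hγ

omit hp in
/-- **A uniform height bound for finitely many elements of `B`** (from `finite_height`).
[folklore] -/
theorem exists_uniform_height (S : Finset B) :
    ∃ N : ℕ, ∀ u ∈ S, ((u : B) : Ω) ≠ 1 → ∀ w ∈ B, w ^ p ^ N ≠ (u : Ω) := by
  classical
  induction S using Finset.induction_on with
  | empty => exact ⟨0, fun u hu => absurd hu (Finset.notMem_empty u)⟩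
  | insert u₀ S hu₀ ih =>
    obtain ⟨N, hN⟩ := ih
    by_cases h1 : ((u₀ : B) : Ω) = 1
    · refine ⟨N, fun u hu hu1 => ?_⟩
      rcases Finset.mem_insert.mp hu with rfl | hu'
      · exact absurd h1 hu1
      · exact hN u hu' hu1
    · obtain ⟨n, hn⟩ := h.finite_height u₀ u₀.2 h1
      refine ⟨max N n, fun u hu hu1 => ?_⟩
      rcases Finset.mem_insert.mp hu with rfl | hu'
      · exact pow_pow_ne_of_le h.pow_mem (le_max_right N n) hn
      · exact pow_pow_ne_of_le h.pow_mem (le_max_left N n) (hN u hu' hu1)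

/-! ### Phase one: conversion of the `p`-th power factors of level `≤ vp` -/

include hKroot in
/-- **Phase one of the normal form** (Kuhlmann 2010, proof of Prop. 4.6: "In a first step, we
will eliminate all `p`-th powers … of value `≤ vp` in the above sum … the first quotient … is
equivalent to `1` modulo `p𝓜_F`"). In product form: the product of the factors `1 + g_u u` with
`u ≠ 1` a `p`-th power in `B` and `v(g_u) ≥ v(p)` is congruent modulo `(F^×)^p` to a `1`-unit of
level `> vp` (each factor is `(1 + d r)^p ρ` with `v(ρ - 1) ≤ v(p)v(d) < v(p)`).
[cite: Kuhlmann2010, Prop. 4.6 (proof) and Prop. 4.13 (proof)] -/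
theorem phase_one (hp0 : (p : Ω) ≠ 0) (hvp : V.valuation (p : Ω) < 1) (g : B →₀ K)
    (hg : ∀ u, V.valuation (g u : Ω) < 1) (S : Finset B)
    (hS : ∀ u ∈ S, ∃ w ∈ B, w ^ p = (u : Ω)) :
    ∃ ρ ∈ F, V.valuation (ρ - 1) < V.valuation (p : Ω) ∧
      ModPthPowers F p (∏ u ∈ S, (1 + (g u : Ω) * (u : Ω))) ρ := by
  classical
  have hP0 : 0 < V.valuation (p : Ω) := (Valuation.pos_iff _).mpr hp0
  induction S using Finset.induction_on with
  | empty => exact ⟨1, F.one_mem, by rw [sub_self, map_zero]; exact hP0, by simpa using ModPthPowers.refl (F := F) (p := p) (1 : Ω)⟩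
  | insert u S hu ih =>
    obtain ⟨ρ, hρF, hρ, hS'⟩ := ih fun w hw => hS w (Finset.mem_insert_of_mem hw)
    obtain ⟨r, hrB, hr⟩ := hS u (Finset.mem_insert_self u S)
    obtain ⟨d, hdK, hd⟩ := hKroot (g u : Ω) (g u).2
    have hvd : V.valuation d < 1 := by
      by_contra hle
      push Not at hle
      have : (1 : V.ValueGroup) ≤ V.valuation (g u : Ω) := by
        rw [← hd, map_pow]
        exact one_le_pow₀ hle
      exact not_lt.mpr this (hg u)
    have hvdr : V.valuation (d * r) < 1 := by
      rw [map_mul, h.valuation_eq_one r hrB, mul_one]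
      exact hvd
    obtain ⟨ρ₁, hρ₁F, heq, hρ₁⟩ := exists_one_add_pow_eq_mul (V := V) (p := p)
      (mul_mem (h.le hdK) (h.subset hrB)) hvdr
    have hρ₁' : V.valuation (ρ₁ - 1) < V.valuation (p : Ω) := by
      refine hρ₁.trans_lt ?_
      calc V.valuation (p : Ω) * V.valuation (d * r) < V.valuation (p : Ω) * 1 :=
            mul_lt_mul_of_pos_left hvdr hP0
        _ = V.valuation (p : Ω) := mul_one _
    refine ⟨ρ₁ * ρ, mul_mem hρ₁F hρF, valuation_mul_sub_one_lt hρ₁' hρ hvp.le, ?_⟩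
    rw [Finset.prod_insert hu]
    refine ModPthPowers.mul ?_ hS'
    -- `1 + g_u u = (1 + d r)^p ρ₁ ≡ ρ₁`
    have key : 1 + (g u : Ω) * (u : Ω) = ρ₁ * (1 + d * r) ^ p := by
      rw [← hd, ← hr, ← mul_pow, heq, mul_comm]
    refine ⟨1 + d * r, add_mem F.one_mem (mul_mem (h.le hdK) (h.subset hrB)), ?_, key⟩
    exact ne_zero_of_sub_one_lt (V := V) (by rwa [add_sub_cancel_left])

/-! ### The normal form -/

include hKroot in
/-- A product representation all of whose support elements are `= 1` is `≡ 1` (its factors are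
non-zero constants). [folklore] -/
theorem modPthPowers_prod_one_of_const (f : B →₀ K) (hf : ∀ u, V.valuation (f u : Ω) < 1)
    (hc : ∀ u ∈ f.support, ((u : B) : Ω) = 1) :
    ModPthPowers F p (∏ u ∈ f.support, (1 + (f u : Ω) * (u : Ω))) 1 := by
  have := ModPthPowers.prod f.support (x := fun u : B => 1 + (f u : Ω) * (u : Ω)) (y := fun _ => (1 : Ω))
    fun u hu => by
      show ModPthPowers F p (1 + (f u : Ω) * (u : Ω)) 1
      rw [hc u hu, mul_one]
      refine modPthPowers_one_of_mem h.le hKroot (add_mem K.one_mem (f u).2) ?_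
      exact ne_zero_of_sub_one_lt (V := V) (by rw [add_sub_cancel_left]; exact hf u)
  rwa [Finset.prod_const_one] at this

include hF hCF hC hp0 hvp hKroot in
/-- A product representation all of whose factors are constants or of level `> λ` is `≡ 1`.
[folklore] -/
theorem modPthPowers_prod_one_of_small (f : B →₀ K) (hf : ∀ u, V.valuation (f u : Ω) < 1)
    (hc : ∀ u ∈ f.support, ((u : B) : Ω) = 1 ∨ V.valuation (f u : Ω) < V.valuation C ^ p) :
    ModPthPowers F p (∏ u ∈ f.support, (1 + (f u : Ω) * (u : Ω))) 1 := by
  have := ModPthPowers.prod f.support (x := fun u : B => 1 + (f u : Ω) * (u : Ω)) (y := fun _ => (1 : Ω))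
    fun u hu => by
      show ModPthPowers F p (1 + (f u : Ω) * (u : Ω)) 1
      rcases hc u hu with h1 | hlt
      · rw [h1, mul_one]
        refine modPthPowers_one_of_mem h.le hKroot (add_mem K.one_mem (f u).2) ?_
        exact ne_zero_of_sub_one_lt (V := V) (by rw [add_sub_cancel_left]; exact hf u)
      · refine modPthPowers_one_of_valuation_sub_one_lt hF hCF hC hp0 hvp
          (add_mem F.one_mem (mul_mem (h.le (f u).2) (h.subset u.2))) ?_
        rwa [add_sub_cancel_left, map_mul, h.valuation_eq_one u u.2, mul_one]
  rwa [Finset.prod_const_one] at this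

include hF hCF hC hp0 hvp hKroot in
/-- **The Kummer normal form for `1`-units (Kuhlmann 2010, Prop. 4.13: "`E = F(ϑ)` where
`ϑ^p = ru` … `u = 1 + ∑_{i∈I} cᵢuᵢ`, `cᵢ ∈ K`, `1 ≠ uᵢ ∈ 𝓑` … `0 < vcᵢuᵢ = vcᵢ ≤ (p/(p-1))vp` and
(`uᵢ ∈ 𝓑^p ⇒ vcᵢ > vp`) … it may be assumed that no `uᵢ` at all appearing in the sum is a `p`-th
power in `𝓑`"), in the form consumed by the residue computation.** For a `1`-unit `w` of the
henselian rank-one field `F ⊇ K ∋ C` (`K` closed under `p`-th roots) carrying a dense lifted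
Frobenius-closed basis `B`: either `w ∈ (F^×)^p`, or `w ≡ 1 + ∑ c_u u + R mod (F^×)^p` for a
non-zero family of coefficients `c_u ∈ K` supported on elements `u ≠ 1` of `B` which are NOT
`p`-th powers in `B`, with `(p/(p-1))vp ≥ v(∑ c_u u)` (multiplicatively `v(C)^p ≤ ·`) and a
remainder `R` of strictly smaller size. PROVED by the product representation
(`exists_prod_mul_one_add`), phase one (`phase_one`), a second product representation of the
part of level `> vp`, phase two (`phase_two`), and the second-order expansion of the resulting
product (whose linear part cannot cancel: the phase-one survivors have level `≤ vp`, the others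
`> vp`). [cite: Kuhlmann2010, Prop. 4.13 (with the proof of Prop. 4.6)] -/
theorem normal_form (hrank : IsRankOneValued V F) {w : Ω} (hwF : w ∈ F)
    (hw : V.valuation (w - 1) < 1) :
    ModPthPowers F p w 1 ∨
      ∃ Fc : B →₀ K, Fc ≠ 0 ∧ (∀ u ∈ Fc.support, ((u : B) : Ω) ≠ 1 ∧ ∀ w' ∈ B, w' ^ p ≠ (u : Ω)) ∧
        ∃ R ∈ F, V.valuation R < V.valuation (Fc.sum fun u c => (c : Ω) * (u : Ω)) ∧
          V.valuation C ^ p ≤ V.valuation (Fc.sum fun u c => (c : Ω) * (u : Ω)) ∧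
          V.valuation (Fc.sum fun u c => (c : Ω) * (u : Ω)) < 1 ∧
          ModPthPowers F p w (1 + (Fc.sum fun u c => (c : Ω) * (u : Ω)) + R) := by
  classical
  have hC0 : C ≠ 0 := C_ne_zero hp.out hC hp0
  have hΛ0 : 0 < V.valuation C ^ p := pow_pos ((Valuation.pos_iff _).mpr hC0) _
  have hΛP : V.valuation C ^ p < V.valuation (p : Ω) := valuation_C_pow_lt_valuation_p V hp.out hC hp0 hvp
  have hP0 : 0 < V.valuation (p : Ω) := (Valuation.pos_iff _).mpr hp0
  ------------------------------------------------------------------ Step 1: product representation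
  obtain ⟨g, hg, t, htF, ht, hwg⟩ :=
    h.exists_prod_mul_one_add hrank hwF hw (_root_.pow_mem hCF p) (pow_ne_zero _ hC0)
  rw [map_pow] at ht
  have hg1 : ∀ u, V.valuation (g u : Ω) < 1 := fun u => (hg u).trans_lt hw
  -- notation-free abbreviation of the products
  have c1 : ModPthPowers F p w (∏ u ∈ g.support, (1 + (g u : Ω) * (u : Ω))) := by
    have h1t : ModPthPowers F p (1 + t) 1 :=
      modPthPowers_one_of_valuation_sub_one_lt hF hCF hC hp0 hvp (add_mem F.one_mem htF)
        (by rwa [add_sub_cancel_left])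
    have := (ModPthPowers.refl (F := F) (p := p) (∏ u ∈ g.support, (1 + (g u : Ω) * (u : Ω)))).mul h1t
    rwa [mul_one, ← hwg] at this
  ------------------------------------------------------------------ Step 2: constants
  set gK := g.filter fun u : B => (u : Ω) = 1 with hgK
  set g' := g.filter fun u : B => ¬ (u : Ω) = 1 with hg'
  have c2 := h.modPthPowers_prod_filter hF hCF hC hp0 hvp g hg1 fun u : B => (u : Ω) = 1
  have hgK1 : ∀ u, V.valuation (gK u : Ω) < 1 := fun u => by
    rw [hgK, Finsupp.filter_apply]; split_ifs
    · exact hg1 u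
    · rw [ZeroMemClass.coe_zero, map_zero]; exact one_pos
  have hg'1 : ∀ u, V.valuation (g' u : Ω) < 1 := fun u => by
    rw [hg', Finsupp.filter_apply]
    by_cases hu : (u : Ω) = 1
    · rw [if_neg (not_not.mpr hu), ZeroMemClass.coe_zero, map_zero]; exact one_pos
    · rw [if_pos hu]; exact hg1 u
  have c3 : ModPthPowers F p (∏ u ∈ gK.support, (1 + (gK u : Ω) * (u : Ω))) 1 :=
    h.modPthPowers_prod_one_of_const hKroot gK hgK1 fun u hu => by
      rw [hgK, Finsupp.support_filter, Finset.mem_filter] at hu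
      exact hu.2
  ------------------------------------------------------------------ Step 3: level `≤ vp` versus `> vp`
  set gb := g'.filter fun u : B => V.valuation (p : Ω) ≤ V.valuation (g' u : Ω) with hgb
  set g₂ := g'.filter fun u : B => ¬ V.valuation (p : Ω) ≤ V.valuation (g' u : Ω) with hg₂
  have c4 := h.modPthPowers_prod_filter hF hCF hC hp0 hvp g' hg'1
    fun u : B => V.valuation (p : Ω) ≤ V.valuation (g' u : Ω)
  have hgb1 : ∀ u, V.valuation (gb u : Ω) < 1 := fun u => by
    rw [hgb, Finsupp.filter_apply]; split_ifs
    · exact hg'1 u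
    · rw [ZeroMemClass.coe_zero, map_zero]; exact one_pos
  have hg₂P : ∀ u, V.valuation (g₂ u : Ω) < V.valuation (p : Ω) := fun u => by
    rw [hg₂, Finsupp.filter_apply]
    by_cases hu : V.valuation (p : Ω) ≤ V.valuation (g' u : Ω)
    · rw [if_neg (not_not.mpr hu), ZeroMemClass.coe_zero, map_zero]; exact hP0
    · rw [if_pos hu]; exact not_le.mp hu
  ------------------------------------------------------------------ Step 4: roots versus non-roots
  set g₁ := gb.filter fun u : B => ∃ w' ∈ B, w' ^ p = (u : Ω) with hg₁
  set g₀ := gb.filter fun u : B => ¬ ∃ w' ∈ B, w' ^ p = (u : Ω) with hg₀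
  have c5 := h.modPthPowers_prod_filter hF hCF hC hp0 hvp gb hgb1 fun u : B => ∃ w' ∈ B, w' ^ p = (u : Ω)
  have hg₁1 : ∀ u, V.valuation (g₁ u : Ω) < 1 := fun u => by
    rw [hg₁, Finsupp.filter_apply]; split_ifs
    · exact hgb1 u
    · rw [ZeroMemClass.coe_zero, map_zero]; exact one_pos
  have hg₀1 : ∀ u, V.valuation (g₀ u : Ω) < 1 := fun u => by
    rw [hg₀, Finsupp.filter_apply]
    by_cases hu : ∃ w' ∈ B, w' ^ p = (u : Ω)
    · rw [if_neg (not_not.mpr hu), ZeroMemClass.coe_zero, map_zero]; exact one_pos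
    · rw [if_pos hu]; exact hgb1 u
  -- the support of `g₀`: non-constant, non-root, level `≤ vp`
  have hg₀supp : ∀ u ∈ g₀.support, ((u : B) : Ω) ≠ 1 ∧ (∀ w' ∈ B, w' ^ p ≠ (u : Ω)) ∧
      V.valuation (p : Ω) ≤ V.valuation (g₀ u : Ω) := by
    intro u hu
    rw [hg₀, Finsupp.support_filter, Finset.mem_filter] at hu
    obtain ⟨hu, hnr⟩ := hu
    rw [hgb, Finsupp.support_filter, Finset.mem_filter] at hu
    obtain ⟨hu', hbig⟩ := hu
    rw [hg', Finsupp.support_filter, Finset.mem_filter] at hu'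
    obtain ⟨-, hne⟩ := hu'
    push Not at hnr
    refine ⟨hne, hnr, ?_⟩
    rw [hg₀, Finsupp.filter_apply, if_pos (by push Not; exact hnr), hgb, Finsupp.filter_apply, if_pos hbig]
    exact hbig
  ------------------------------------------------------------------ Step 5: phase one
  obtain ⟨ρ, hρF, hρ, c6⟩ := h.phase_one hKroot hp0 hvp g₁ hg₁1 g₁.support fun u hu => by
    rw [hg₁, Finsupp.support_filter, Finset.mem_filter] at hu
    exact hu.2
  ------------------------------------------------------------------ Step 6: the part `M` of level `> vp`
  set Pg₀ := ∏ u ∈ g₀.support, (1 + (g₀ u : Ω) * (u : Ω)) with hPg₀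
  set Pg₂ := ∏ u ∈ g₂.support, (1 + (g₂ u : Ω) * (u : Ω)) with hPg₂
  set M := ρ * Pg₂ with hM
  have hPg₂1 : V.valuation (Pg₂ - 1) < V.valuation (p : Ω) :=
    valuation_prod_sub_one_lt g₂.support (fun u : B => 1 + (g₂ u : Ω) * (u : Ω)) hP0 hvp.le
      fun u _ => by
        show V.valuation (1 + (g₂ u : Ω) * (u : Ω) - 1) < _
        rw [add_sub_cancel_left, map_mul, h.valuation_eq_one u u.2, mul_one]
        exact hg₂P u
  have hM1 : V.valuation (M - 1) < V.valuation (p : Ω) := valuation_mul_sub_one_lt hρ hPg₂1 hvp.le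
  have hMF : M ∈ F := mul_mem hρF (h.prod_one_add_mem g₂ _)
  have cM : ModPthPowers F p w (Pg₀ * M) := by
    refine c1.trans (c2.trans ?_)
    refine (c3.mul (c4.trans ((c5.trans (c6.mul (ModPthPowers.refl _))).mul (ModPthPowers.refl _)))).trans ?_
    exact ModPthPowers.of_eq (by rw [hM, hPg₀, hPg₂]; ring)
  ------------------------------------------------------------------ Step 7: product representation of `M`
  obtain ⟨hh, hhh, t₂, ht₂F, ht₂, hMh⟩ :=
    h.exists_prod_mul_one_add hrank hMF (hM1.trans hvp) (_root_.pow_mem hCF p) (pow_ne_zero _ hC0)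
  rw [map_pow] at ht₂
  have hhhP : ∀ u, V.valuation (hh u : Ω) < V.valuation (p : Ω) := fun u => (hhh u).trans_lt hM1
  have c7 : ModPthPowers F p M (∏ u ∈ hh.support, (1 + (hh u : Ω) * (u : Ω))) := by
    have h1t : ModPthPowers F p (1 + t₂) 1 :=
      modPthPowers_one_of_valuation_sub_one_lt hF hCF hC hp0 hvp (add_mem F.one_mem ht₂F)
        (by rwa [add_sub_cancel_left])
    have := (ModPthPowers.refl (F := F) (p := p) (∏ u ∈ hh.support, (1 + (hh u : Ω) * (u : Ω)))).mul h1t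
    rwa [mul_one, ← hMh] at this
  ------------------------------------------------------------------ Step 8: phase two
  obtain ⟨N, hN⟩ := h.exists_uniform_height hh.support
  obtain ⟨h', hh'root, hh'P, c8⟩ := h.phase_two hF hCF hC hp0 hvp hKroot N hh hN hhhP
  have hh'1 : ∀ u, V.valuation (h' u : Ω) < 1 := fun u => (hh'P u).trans hvp
  ------------------------------------------------------------------ Step 9: discard constants and small terms
  set h'' := h'.filter fun u : B => (u : Ω) ≠ 1 ∧ V.valuation C ^ p ≤ V.valuation (h' u : Ω) with hh''
  have c9 := h.modPthPowers_prod_filter hF hCF hC hp0 hvp h' hh'1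
    fun u : B => (u : Ω) ≠ 1 ∧ V.valuation C ^ p ≤ V.valuation (h' u : Ω)
  have c10 : ModPthPowers F p
      (∏ u ∈ (h'.filter fun u : B => ¬((u : Ω) ≠ 1 ∧ V.valuation C ^ p ≤ V.valuation (h' u : Ω))).support,
        (1 + ((h'.filter fun u : B => ¬((u : Ω) ≠ 1 ∧ V.valuation C ^ p ≤ V.valuation (h' u : Ω))) u : Ω) *
          (u : Ω))) 1 := by
    refine h.modPthPowers_prod_one_of_small hF hCF hC hp0 hvp hKroot _ (fun u => ?_) (fun u hu => ?_)
    · rw [Finsupp.filter_apply]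
      by_cases hc : ¬(((u : B) : Ω) ≠ 1 ∧ V.valuation C ^ p ≤ V.valuation (h' u : Ω))
      · rw [if_pos hc]; exact hh'1 u
      · rw [if_neg hc, ZeroMemClass.coe_zero, map_zero]; exact one_pos
    · rw [Finsupp.support_filter, Finset.mem_filter] at hu
      obtain ⟨hu, hnot⟩ := hu
      rw [Finsupp.filter_apply, if_pos hnot]
      by_cases h1 : ((u : B) : Ω) = 1
      · exact Or.inl h1
      · right
        by_contra hle
        exact hnot ⟨h1, not_lt.mp hle⟩
  have hh''supp : ∀ u ∈ h''.support, ((u : B) : Ω) ≠ 1 ∧ (∀ w' ∈ B, w' ^ p ≠ (u : Ω)) ∧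
      V.valuation C ^ p ≤ V.valuation (h'' u : Ω) ∧ V.valuation (h'' u : Ω) < V.valuation (p : Ω) := by
    intro u hu
    rw [hh'', Finsupp.support_filter, Finset.mem_filter] at hu
    obtain ⟨hu, hne, hbig⟩ := hu
    refine ⟨hne, hh'root u hu hne, ?_, ?_⟩
    · rw [hh'', Finsupp.filter_apply, if_pos ⟨hne, hbig⟩]; exact hbig
    · rw [hh'', Finsupp.filter_apply, if_pos ⟨hne, hbig⟩]; exact hh'P u
  have hh''P : ∀ u, V.valuation (h'' u : Ω) < V.valuation (p : Ω) := fun u => by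
    rw [hh'', Finsupp.filter_apply]
    by_cases hc : ((u : B) : Ω) ≠ 1 ∧ V.valuation C ^ p ≤ V.valuation (h' u : Ω)
    · rw [if_pos hc]; exact hh'P u
    · rw [if_neg hc, ZeroMemClass.coe_zero, map_zero]; exact hP0
  set Ph'' := ∏ u ∈ h''.support, (1 + (h'' u : Ω) * (u : Ω)) with hPh''
  have cfin : ModPthPowers F p w (Pg₀ * Ph'') := by
    refine cM.trans ?_
    refine ((ModPthPowers.refl Pg₀).mul (c7.trans (c8.trans (c9.trans ((ModPthPowers.refl _).mul c10))))).trans ?_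
    exact ModPthPowers.of_eq (by rw [hPh'', mul_one])
  ------------------------------------------------------------------ Step 10: the linear part
  set Fc := g₀ + h'' with hFc
  by_cases hFc0 : Fc = 0
  · -- everything cancelled: `g₀ = 0` and `h'' = 0`, so `w ≡ 1`
    left
    have hg₀0 : g₀ = 0 := by
      ext u
      by_contra hne
      have hu : u ∈ g₀.support := Finsupp.mem_support_iff.mpr fun h0 => hne (by rw [h0]; rfl)
      obtain ⟨-, -, hbig⟩ := hg₀supp u hu
      have hsum : (g₀ u : Ω) + (h'' u : Ω) = 0 := by
        have := DFunLike.congr_fun hFc0 u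
        rw [hFc, Finsupp.add_apply] at this
        rw [← Subfield.coe_add, this]; rfl
      have heq : (g₀ u : Ω) = -(h'' u : Ω) := eq_neg_of_add_eq_zero_left hsum
      have : V.valuation (g₀ u : Ω) < V.valuation (p : Ω) := by
        rw [heq, Valuation.map_neg]; exact hh''P u
      exact not_le.mpr this hbig
    have hh''0 : h'' = 0 := by
      have : g₀ + h'' = 0 := hFc0
      rwa [hg₀0, zero_add] at this
    have hP1 : Pg₀ = 1 := by rw [hPg₀, hg₀0, Finsupp.support_zero, Finset.prod_empty]
    have hP2 : Ph'' = 1 := by rw [hPh'', hh''0, Finsupp.support_zero, Finset.prod_empty]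
    rw [hP1, hP2, mul_one] at cfin
    exact cfin
  right
  -- the linear parts and their sizes
  set L₀ := g₀.sum fun u c => (c : Ω) * (u : Ω) with hL₀
  set L₁ := h''.sum fun u c => (c : Ω) * (u : Ω) with hL₁
  set γ₀ := V.valuation L₀ with hγ₀
  set γ₁ := V.valuation L₁ with hγ₁
  have hLFc : (Fc.sum fun u c => (c : Ω) * (u : Ω)) = L₀ + L₁ := by rw [hFc, lc_add]
  set γ := V.valuation (Fc.sum fun u c => (c : Ω) * (u : Ω)) with hγ
  have hγ₁P : γ₁ < V.valuation (p : Ω) := by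
    by_cases h0 : h'' = 0
    · rw [hγ₁, hL₁, h0, Finsupp.sum_zero_index, map_zero]; exact hP0
    · obtain ⟨u, -, heq, -⟩ := h.exists_valuation_lc_eq h'' h0
      rw [hγ₁, hL₁, heq]; exact hh''P u
  -- `γ = max(γ₀, γ₁)`, `Λ ≤ γ`
  have hkey : γ₀ ≤ γ ∧ γ₁ ≤ γ ∧ V.valuation C ^ p ≤ γ := by
    by_cases h0 : g₀ = 0
    · have hL₀0 : L₀ = 0 := by rw [hL₀, h0, Finsupp.sum_zero_index]
      have hγeq : γ = γ₁ := by rw [hγ, hLFc, hL₀0, zero_add]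
      have hh''0 : h'' ≠ 0 := fun h1 => hFc0 (by rw [hFc, h0, h1, add_zero])
      obtain ⟨u, hu, heq, -⟩ := h.exists_valuation_lc_eq h'' hh''0
      obtain ⟨-, -, hbig, -⟩ := hh''supp u hu
      refine ⟨by rw [hγ₀, hL₀0, map_zero]; exact zero_le, hγeq.ge, ?_⟩
      rw [hγeq, hγ₁, hL₁, heq]; exact hbig
    · obtain ⟨u, hu, heq, -⟩ := h.exists_valuation_lc_eq g₀ h0
      obtain ⟨-, -, hbig⟩ := hg₀supp u hu
      have hγ₀P : V.valuation (p : Ω) ≤ γ₀ := by rw [hγ₀, hL₀, heq]; exact hbig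
      have hlt : γ₁ < γ₀ := hγ₁P.trans_le hγ₀P
      have hγeq : γ = γ₀ := by
        rw [hγ, hLFc, hγ₀]
        exact Valuation.map_add_eq_of_lt_left _ hlt
      exact ⟨hγeq.ge, hγeq ▸ hlt.le, (hΛP.le.trans hγ₀P).trans hγeq.ge⟩
  obtain ⟨hγ₀γ, hγ₁γ, hΛγ⟩ := hkey
  have hγ1 : γ < 1 := by
    obtain ⟨u, -, heq, -⟩ := h.exists_valuation_lc_eq Fc hFc0
    rw [hγ, heq, hFc, Finsupp.add_apply, Subfield.coe_add]
    exact Valuation.map_add_lt _ (hg₀1 u) ((hh''P u).trans hvp)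
  have hγpos : 0 < γ := lt_of_lt_of_le hΛ0 hΛγ
  -- second-order expansions
  have hR₀ : V.valuation (Pg₀ - 1 - L₀) ≤ γ₀ * γ₀ := by
    rw [hPg₀, hL₀, lc_eq_sum]
    refine valuation_prod_one_add_sub_le g₀.support (fun u : B => (g₀ u : Ω) * (u : Ω))
      (hγ₀γ.trans hγ1.le) fun u _ => ?_
    rw [map_mul, h.valuation_eq_one u u.2, mul_one, hγ₀, hL₀]
    exact h.valuation_coeff_le_valuation_lc g₀ u
  have hR₁ : V.valuation (Ph'' - 1 - L₁) ≤ γ₁ * γ₁ := by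
    rw [hPh'', hL₁, lc_eq_sum]
    refine valuation_prod_one_add_sub_le h''.support (fun u : B => (h'' u : Ω) * (u : Ω))
      (hγ₁γ.trans hγ1.le) fun u _ => ?_
    rw [map_mul, h.valuation_eq_one u u.2, mul_one, hγ₁, hL₁]
    exact h.valuation_coeff_le_valuation_lc h'' u
  set R := Pg₀ * Ph'' - 1 - (L₀ + L₁) with hR
  have hRval : V.valuation R < γ := by
    have key : R = (Pg₀ - 1 - L₀) + (Ph'' - 1 - L₁) + (L₀ + (Pg₀ - 1 - L₀)) * (L₁ + (Ph'' - 1 - L₁)) := by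
      rw [hR]; ring
    have hA : V.valuation (L₀ + (Pg₀ - 1 - L₀)) ≤ γ :=
      Valuation.map_add_le _ hγ₀γ (hR₀.trans ((mul_le_mul' hγ₀γ hγ₀γ).trans (mul_le_of_le_one_right' hγ1.le)))
    have hB : V.valuation (L₁ + (Ph'' - 1 - L₁)) ≤ γ :=
      Valuation.map_add_le _ hγ₁γ (hR₁.trans ((mul_le_mul' hγ₁γ hγ₁γ).trans (mul_le_of_le_one_right' hγ1.le)))
    have hγγ : γ * γ < γ := by
      calc γ * γ < γ * 1 := mul_lt_mul_of_pos_left hγ1 hγpos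
        _ = γ := mul_one _
    rw [key]
    refine lt_of_le_of_lt ?_ hγγ
    refine Valuation.map_add_le _ (Valuation.map_add_le _ (hR₀.trans (mul_le_mul' hγ₀γ hγ₀γ))
      (hR₁.trans (mul_le_mul' hγ₁γ hγ₁γ))) ?_
    rw [map_mul]
    exact mul_le_mul' hA hB
  have hRval' : V.valuation R < V.valuation (Fc.sum fun u c => (c : Ω) * (u : Ω)) := by rw [← hγ]; exact hRval
  refine ⟨Fc, hFc0, fun u hu => ?_, R, ?_, hRval', hΛγ, hγ1, ?_⟩
  · -- support of `Fc`
    have hu' := Finsupp.support_add hu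
    rcases Finset.mem_union.mp hu' with h0 | h1
    · obtain ⟨hne, hnr, -⟩ := hg₀supp u h0
      exact ⟨hne, hnr⟩
    · obtain ⟨hne, hnr, -⟩ := hh''supp u h1
      exact ⟨hne, hnr⟩
  · -- `R ∈ F`
    rw [hR]
    exact sub_mem (sub_mem (mul_mem (h.prod_one_add_mem g₀ _) (h.prod_one_add_mem h'' _)) F.one_mem)
      (add_mem (h.lc_mem g₀) (h.lc_mem h''))
  · rw [hLFc]
    refine cfin.trans (ModPthPowers.of_eq ?_)
    rw [hR]; ring

end IsDenseLiftedFrobeniusClosedBasis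

end Literature.AlgebraicGeometry.Resolution
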